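import Literature.Probability.Distributions.GaussianWickSpace
import Mathlib.MeasureTheory.Function.L2Space
import Mathlib.Analysis.InnerProductSpace.Projection.Basic
import Mathlib.MeasureTheory.Integral.DominatedConvergence
import Mathlib.MeasureTheory.Measure.CharacteristicFunction.Basic
import Mathlib.Analysis.SpecialFunctions.Exponential
import Mathlib.Probability.Distributions.Gaussian.Fernique
import HarnessLib

/-!
# Polynomials are dense in `L²` of a finite-dimensional Gaussian measure

For a finite-dimensional real inner product space `E` with its standard Gaussian `γ` and an
orthonormal basis `b`, the Wick polynomials `𝓗_b q` (`GaussianHermiteChaos.hermiteEval`) — equivalently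
all polynomial functions (`GaussianWickSpace.wickSpace_eq_polySpace`) — are dense in `L²(γ)`
(Janson 1997, Theorem 2.11 with Theorem 2.6):

* `ae_eq_zero_of_forall_integral_mul_hermiteEval_eq_zero` : if `h ∈ L²(γ)` is orthogonal to every
  Wick polynomial then `h = 0` a.e. Proof (Janson's, Thm 2.6): `h` is then orthogonal to every
  ridge monomial `⟪·, t⟫ⁿ`; writing `h = h⁺ - h⁻`, the finite measures `h^± γ` have the same
  characteristic function — expand `e^{i⟪v,t⟫}` in its power series under the integral, by dominated
  convergence with the Gaussian-integrable bound `|h| e^{‖t‖ ‖v‖}` (Fernique) — hence coincide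
  (`Measure.ext_of_charFun`), so `h⁺ = h⁻` a.e.
* `exists_hermiteEval_sub_eLpNorm_lt` : for `g ∈ L²(γ)` and `ε > 0` there is a polynomial `q` with
  `‖g - 𝓗_b q‖_{L²(γ)} < ε` (orthogonal complement `= ⊥` ⇒ dense, in the Hilbert space `Lp ℝ 2 γ`).

## References
* S. Janson, *Gaussian Hilbert Spaces* (1997), Theorem 2.6 (proof) and Theorem 2.11.
-/

open MeasureTheory ProbabilityTheory Filter Topology Finset Complex
open scoped InnerProductSpace ENNReal Nat

namespace Literature.Probability.Distributions

noncomputable section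

variable {E : Type*} [NormedAddCommGroup E] [InnerProductSpace ℝ E] [FiniteDimensional ℝ E]
  [MeasurableSpace E] [BorelSpace E]
variable {ι : Type*} [Fintype ι] [DecidableEq ι]

/-! ### Exponential moments of the standard Gaussian (Fernique) -/

omit [DecidableEq ι] in
/-- `e^{a ‖v‖}` is integrable against the standard Gaussian (from Fernique's theorem). [folklore] -/
theorem integrable_exp_mul_norm_stdGaussian (a : ℝ) :
    Integrable (fun v : E => Real.exp (a * ‖v‖)) (stdGaussian E) := by
  obtain ⟨C, hC, hint⟩ := IsGaussian.exists_integrable_exp_sq (stdGaussian E)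
  refine (hint.const_mul (Real.exp (a ^ 2 / (4 * C)))).mono' (by fun_prop) (ae_of_all _ fun v => ?_)
  rw [Real.norm_eq_abs, abs_of_pos (Real.exp_pos _), ← Real.exp_add]
  refine Real.exp_le_exp.2 ?_
  have h4C : 0 < 4 * C := by positivity
  have key : a * ‖v‖ * (4 * C) ≤ (a ^ 2 / (4 * C) + C * ‖v‖ ^ 2) * (4 * C) := by
    rw [add_mul, div_mul_cancel₀ _ h4C.ne']
    nlinarith [sq_nonneg (a - 2 * C * ‖v‖)]
  exact le_of_mul_le_mul_right key h4C

omit [DecidableEq ι] in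
/-- `e^{a ‖v‖} ∈ L²(γ)`. [folklore] -/
theorem memLp_two_exp_mul_norm_stdGaussian (a : ℝ) :
    MemLp (fun v : E => Real.exp (a * ‖v‖)) 2 (stdGaussian E) := by
  refine (memLp_two_iff_integrable_sq (by fun_prop)).2 ?_
  have : (fun v : E => Real.exp (a * ‖v‖) ^ 2) = fun v => Real.exp ((2 * a) * ‖v‖) := by
    funext v; rw [sq, ← Real.exp_add]; ring_nf
  rw [this]
  exact integrable_exp_mul_norm_stdGaussian (2 * a)

/-! ### Ridge monomials are Wick polynomials -/

omit [FiniteDimensional ℝ E] [MeasurableSpace E] [BorelSpace E] [DecidableEq ι] in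
/-- `⟪v, t⟫ = Σⱼ ⟪bⱼ, t⟫ ⟪bⱼ, v⟫`. [folklore] -/
theorem inner_eq_sum_coord (b : OrthonormalBasis ι ℝ E) (t v : E) :
    ⟪v, t⟫_ℝ = ∑ j, ⟪b j, t⟫_ℝ * ⟪b j, v⟫_ℝ := by
  conv_lhs => rw [← b.sum_repr' v]
  rw [sum_inner]
  refine Finset.sum_congr rfl fun j _ => ?_
  rw [real_inner_smul_left, mul_comm]

omit [FiniteDimensional ℝ E] [MeasurableSpace E] [BorelSpace E] [DecidableEq ι] in
/-- The ridge monomial `v ↦ ⟪v, t⟫ⁿ` is a polynomial function of degree `≤ n`. [folklore] -/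
theorem inner_pow_mem_polySpace (b : OrthonormalBasis ι ℝ E) (t : E) (n : ℕ) :
    (fun v => ⟪v, t⟫_ℝ ^ n) ∈ polySpace b n := by
  set ℓ : MvPolynomial ι ℝ := ∑ j, ⟪b j, t⟫_ℝ • MvPolynomial.X j with hℓ
  refine ⟨ℓ ^ n, ?_, ?_⟩
  · rw [SetLike.mem_coe, MvPolynomial.mem_restrictTotalDegree]
    refine (MvPolynomial.totalDegree_pow _ _).trans ?_
    have h1 : ℓ.totalDegree ≤ 1 := by
      refine (MvPolynomial.totalDegree_finsetSum _ _).trans (Finset.sup_le fun j _ => ?_)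
      exact (MvPolynomial.totalDegree_smul_le _ _).trans (by rw [MvPolynomial.totalDegree_X])
    calc n * ℓ.totalDegree ≤ n * 1 := Nat.mul_le_mul_left n h1
      _ = n := mul_one n
  · funext v
    simp only [coordEvalₗ_apply, map_pow, hℓ, map_sum, map_smul, MvPolynomial.aeval_X, smul_eq_mul,
      ← inner_eq_sum_coord b t v]

/-- The ridge monomial `⟪·, t⟫ⁿ` is a Wick polynomial: `⟪·, t⟫ⁿ = 𝓗_b q` for some `q`. [folklore] -/
theorem exists_hermiteEval_eq_inner_pow (b : OrthonormalBasis ι ℝ E) (t : E) (n : ℕ) :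
    ∃ q : MvPolynomial ι ℝ, hermiteEval b q = fun v => ⟪v, t⟫_ℝ ^ n := by
  have h := inner_pow_mem_polySpace b t n
  rw [← wickSpace_eq_polySpace] at h
  obtain ⟨q, -, hq⟩ := h
  exact ⟨q, hq⟩

/-! ### Orthogonality to all polynomials forces vanishing -/

omit [FiniteDimensional ℝ E] [MeasurableSpace E] [BorelSpace E] [DecidableEq ι] in
/-- The truncated exponential integrand is dominated by `|h| e^{‖t‖ ‖v‖}`. [folklore] -/
theorem norm_mul_sum_pow_div_le {h : E → ℝ} (t v : E) (N : ℕ) {w : ℝ} (hw0 : 0 ≤ w) (hwh : w ≤ |h v|) :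
    ‖(w : ℂ) * ∑ n ∈ Finset.range N, ((⟪v, t⟫_ℝ : ℂ) * I) ^ n / (n ! : ℂ)‖ ≤
      |h v| * Real.exp (‖t‖ * ‖v‖) := by
  rw [norm_mul, Complex.norm_real, Real.norm_eq_abs, abs_of_nonneg hw0]
  refine mul_le_mul hwh ?_ (norm_nonneg _) (abs_nonneg _)
  refine (norm_sum_le _ _).trans ?_
  have hn : ∀ n ∈ Finset.range N, ‖((⟪v, t⟫_ℝ : ℂ) * I) ^ n / (n ! : ℂ)‖ = |⟪v, t⟫_ℝ| ^ n / n ! := by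
    intro n _
    rw [norm_div, norm_pow, norm_mul, Complex.norm_real, Complex.norm_I, mul_one, Real.norm_eq_abs,
      Complex.norm_natCast]
  rw [Finset.sum_congr rfl hn]
  refine (Real.sum_le_exp_of_nonneg (abs_nonneg _) N).trans (Real.exp_le_exp.2 ?_)
  rw [mul_comm]
  exact (abs_real_inner_le_norm v t)

/-- The truncated exponential against a weight `w ∈ L²`: integral `= Σ_{n<N} Iⁿ/n! ∫ w ⟪v,t⟫ⁿ`. [folklore] -/
theorem integral_mul_sum_pow_div {w : E → ℝ} (hw : MemLp w 2 (stdGaussian E)) (t : E) (N : ℕ) :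
    ∫ v, (w v : ℂ) * ∑ n ∈ Finset.range N, ((⟪v, t⟫_ℝ : ℂ) * I) ^ n / (n ! : ℂ) ∂stdGaussian E =
      ∑ n ∈ Finset.range N, I ^ n / (n ! : ℂ) * ((∫ v, w v * ⟪v, t⟫_ℝ ^ n ∂stdGaussian E : ℝ) : ℂ) := by
  have hI : ∀ n, Integrable (fun v : E => w v * ⟪v, t⟫_ℝ ^ n) (stdGaussian E) := by
    intro n
    refine hw.integrable_mul (q := 2) ?_
    refine (memLp_two_iff_integrable_sq (by fun_prop)).2 ?_
    have hb : ∀ v : E, ‖(⟪v, t⟫_ℝ ^ n) ^ 2‖ ≤ Real.exp ((2 * n * ‖t‖) * ‖v‖) := by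
      intro v
      rw [Real.norm_eq_abs, abs_of_nonneg (sq_nonneg _), ← pow_mul]
      have h1 : |⟪v, t⟫_ℝ| ≤ ‖t‖ * ‖v‖ := by rw [mul_comm]; exact abs_real_inner_le_norm v t
      calc (⟪v, t⟫_ℝ) ^ (n * 2) ≤ |⟪v, t⟫_ℝ| ^ (n * 2) := by
              rw [Even.pow_abs ⟨n, by ring⟩]
            _ ≤ (‖t‖ * ‖v‖) ^ (n * 2) := pow_le_pow_left₀ (abs_nonneg _) h1 _
            _ ≤ Real.exp ((2 * n * ‖t‖) * ‖v‖) := by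
              have h2 : (‖t‖ * ‖v‖) ^ (n * 2) ≤ Real.exp (‖t‖ * ‖v‖) ^ (n * 2) :=
                pow_le_pow_left₀ (by positivity) (by linarith [Real.add_one_le_exp (‖t‖ * ‖v‖)]) _
              rw [← Real.exp_nat_mul] at h2
              refine h2.trans (le_of_eq ?_)
              congr 1; push_cast; ring
    exact (integrable_exp_mul_norm_stdGaussian _).mono' (by fun_prop) (ae_of_all _ hb)
  have hIc : ∀ n, Integrable (fun v : E => (w v : ℂ) * (((⟪v, t⟫_ℝ : ℂ) * I) ^ n / (n ! : ℂ)))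
      (stdGaussian E) := by
    intro n
    have : (fun v : E => (w v : ℂ) * (((⟪v, t⟫_ℝ : ℂ) * I) ^ n / (n ! : ℂ))) =
        fun v => ((w v * ⟪v, t⟫_ℝ ^ n : ℝ) : ℂ) * (I ^ n / (n ! : ℂ)) := by
      funext v; push_cast; ring
    rw [this]
    exact ((hI n).ofReal).mul_const _
  simp_rw [Finset.mul_sum]
  rw [integral_finsetSum _ fun n _ => hIc n]
  refine Finset.sum_congr rfl fun n _ => ?_
  have : (fun v : E => (w v : ℂ) * (((⟪v, t⟫_ℝ : ℂ) * I) ^ n / (n ! : ℂ))) =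
      fun v => (I ^ n / (n ! : ℂ)) * ((w v * ⟪v, t⟫_ℝ ^ n : ℝ) : ℂ) := by
    funext v; push_cast; ring
  rw [this, integral_const_mul, integral_complex_ofReal]

/-- The characteristic function of the weighted Gaussian `w γ` for `0 ≤ w ≤ |h|`, `h ∈ L²`, as the
limit of its truncated power series. [folklore] -/
theorem tendsto_charFun_withDensity {h w : E → ℝ} (hh : MemLp h 2 (stdGaussian E)) (hwm : Measurable w)
    (hw0 : ∀ v, 0 ≤ w v) (hwh : ∀ v, w v ≤ |h v|) (t : E) :
    Tendsto (fun N => ∑ n ∈ Finset.range N, I ^ n / (n ! : ℂ) *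
        ((∫ v, w v * ⟪v, t⟫_ℝ ^ n ∂stdGaussian E : ℝ) : ℂ)) atTop
      (𝓝 (charFun ((stdGaussian E).withDensity fun v => ENNReal.ofReal (w v)) t)) := by
  have hw : MemLp w 2 (stdGaussian E) :=
    hh.norm.mono' hwm.aestronglyMeasurable (ae_of_all _ fun v => by
      rw [Real.norm_eq_abs, abs_of_nonneg (hw0 v), Real.norm_eq_abs]; exact hwh v)
  -- the characteristic function as a `γ`-integral
  have hcf : charFun ((stdGaussian E).withDensity fun v => ENNReal.ofReal (w v)) t =
      ∫ v, (w v : ℂ) * cexp ((⟪v, t⟫_ℝ : ℂ) * I) ∂stdGaussian E := by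
    rw [charFun_apply, integral_withDensity_eq_integral_toReal_smul₀ hwm.ennreal_ofReal.aemeasurable
      (ae_of_all _ fun v => ENNReal.ofReal_lt_top)]
    refine integral_congr_ae (ae_of_all _ fun v => ?_)
    dsimp only
    rw [ENNReal.toReal_ofReal (hw0 v), real_smul]
  rw [hcf]
  simp_rw [← integral_mul_sum_pow_div hw t]
  refine tendsto_integral_of_dominated_convergence (fun v => |h v| * Real.exp (‖t‖ * ‖v‖))
    (fun N => ?_) ?_ (fun N => ae_of_all _ fun v => norm_mul_sum_pow_div_le t v N (hw0 v) (hwh v)) ?_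
  · exact ((Complex.measurable_ofReal.comp hwm).mul
      (Continuous.measurable (by fun_prop))).aestronglyMeasurable
  · exact hh.norm.integrable_mul (memLp_two_exp_mul_norm_stdGaussian ‖t‖) |>.congr
      (ae_of_all _ fun v => by simp [Real.norm_eq_abs])
  · refine ae_of_all _ fun v => Tendsto.const_mul _ ?_
    have hs := NormedSpace.expSeries_div_hasSum_exp ((⟪v, t⟫_ℝ : ℂ) * I)
    have he : NormedSpace.exp ((⟪v, t⟫_ℝ : ℂ) * I) = cexp ((⟪v, t⟫_ℝ : ℂ) * I) :=
      (congrFun Complex.exp_eq_exp_ℂ ((⟪v, t⟫_ℝ : ℂ) * I)).symm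
    rw [he] at hs
    exact hs.tendsto_sum_nat

/-- **Orthogonality to all Wick polynomials forces vanishing** (Janson 1997, proof of Thm 2.6):
if `h ∈ L²(γ)` is measurable and `∫ h · 𝓗_b q dγ = 0` for every polynomial `q`, then `h = 0` a.e. [cite: Janson1997, Thm 2.6] -/
theorem ae_eq_zero_of_forall_integral_mul_hermiteEval_eq_zero (b : OrthonormalBasis ι ℝ E)
    {h : E → ℝ} (hhm : Measurable h) (hh : MemLp h 2 (stdGaussian E))
    (horth : ∀ q : MvPolynomial ι ℝ, ∫ v, h v * hermiteEval b q v ∂stdGaussian E = 0) :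
    h =ᵐ[stdGaussian E] 0 := by
  -- ridge moments vanish
  have hmom : ∀ (t : E) (n : ℕ), ∫ v, h v * ⟪v, t⟫_ℝ ^ n ∂stdGaussian E = 0 := by
    intro t n
    obtain ⟨q, hq⟩ := exists_hermiteEval_eq_inner_pow b t n
    have := horth q
    rw [hq] at this
    exact this
  -- positive and negative parts
  set hp : E → ℝ := fun v => max (h v) 0 with hhp
  set hm : E → ℝ := fun v => max (-h v) 0 with hhm'
  have hpm : Measurable hp := hhm.max measurable_const
  have hmm : Measurable hm := hhm.neg.max measurable_const
  have hp0 : ∀ v, 0 ≤ hp v := fun v => le_max_right _ _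
  have hm0 : ∀ v, 0 ≤ hm v := fun v => le_max_right _ _
  have hph : ∀ v, hp v ≤ |h v| := fun v => max_le (le_abs_self _) (abs_nonneg _)
  have hmh : ∀ v, hm v ≤ |h v| := fun v => max_le (neg_le_abs _) (abs_nonneg _)
  have hsub : ∀ v, hp v - hm v = h v := fun v => by
    simp only [hhp, hhm']
    rcases le_total 0 (h v) with h0 | h0
    · rw [max_eq_left h0, max_eq_right (by linarith), sub_zero]
    · rw [max_eq_right h0, max_eq_left (by linarith)]; ring
  -- equal moments
  have hint : ∀ (w : E → ℝ), Measurable w → (∀ v, 0 ≤ w v) → (∀ v, w v ≤ |h v|) → ∀ n (t : E),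
      Integrable (fun v => w v * ⟪v, t⟫_ℝ ^ n) (stdGaussian E) := by
    intro w hwm hw0 hwh n t
    have hw : MemLp w 2 (stdGaussian E) :=
      hh.norm.mono' hwm.aestronglyMeasurable (ae_of_all _ fun v => by
        rw [Real.norm_eq_abs, abs_of_nonneg (hw0 v), Real.norm_eq_abs]; exact hwh v)
    have := integral_mul_sum_pow_div hw t (n + 1)
    -- integrability is a by-product of `integral_mul_sum_pow_div`'s proof; redo it directly
    refine hw.integrable_mul (q := 2) ((memLp_two_iff_integrable_sq (by fun_prop)).2 ?_)
    have hb : ∀ v : E, ‖(⟪v, t⟫_ℝ ^ n) ^ 2‖ ≤ Real.exp ((2 * n * ‖t‖) * ‖v‖) := by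
      intro v
      rw [Real.norm_eq_abs, abs_of_nonneg (sq_nonneg _), ← pow_mul]
      have h1 : |⟪v, t⟫_ℝ| ≤ ‖t‖ * ‖v‖ := by rw [mul_comm]; exact abs_real_inner_le_norm v t
      calc (⟪v, t⟫_ℝ) ^ (n * 2) ≤ |⟪v, t⟫_ℝ| ^ (n * 2) := by rw [Even.pow_abs ⟨n, by ring⟩]
        _ ≤ (‖t‖ * ‖v‖) ^ (n * 2) := pow_le_pow_left₀ (abs_nonneg _) h1 _
        _ ≤ Real.exp ((2 * n * ‖t‖) * ‖v‖) := by
          have h2 : (‖t‖ * ‖v‖) ^ (n * 2) ≤ Real.exp (‖t‖ * ‖v‖) ^ (n * 2) :=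
            pow_le_pow_left₀ (by positivity) (by linarith [Real.add_one_le_exp (‖t‖ * ‖v‖)]) _
          rw [← Real.exp_nat_mul] at h2
          refine h2.trans (le_of_eq ?_)
          congr 1; push_cast; ring
    exact (integrable_exp_mul_norm_stdGaussian _).mono' (by fun_prop) (ae_of_all _ hb)
  have heq : ∀ (n : ℕ) (t : E), ∫ v, hp v * ⟪v, t⟫_ℝ ^ n ∂stdGaussian E =
      ∫ v, hm v * ⟪v, t⟫_ℝ ^ n ∂stdGaussian E := by
    intro n t
    have h1 := hint hp hpm hp0 hph n t
    have h2 := hint hm hmm hm0 hmh n t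
    have hdiff : ∫ v, hp v * ⟪v, t⟫_ℝ ^ n ∂stdGaussian E - ∫ v, hm v * ⟪v, t⟫_ℝ ^ n ∂stdGaussian E = 0 := by
      rw [← integral_sub h1 h2, ← hmom t n]
      refine integral_congr_ae (ae_of_all _ fun v => ?_)
      simp only [← sub_mul, hsub]
    linarith
  -- equal characteristic functions of `hp γ` and `hm γ`
  set μp := (stdGaussian E).withDensity fun v => ENNReal.ofReal (hp v) with hμp
  set μm := (stdGaussian E).withDensity fun v => ENNReal.ofReal (hm v) with hμm
  have hL1 : Integrable h (stdGaussian E) := hh.integrable one_le_two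
  have hIp : Integrable hp (stdGaussian E) :=
    hL1.norm.mono' hpm.aestronglyMeasurable (ae_of_all _ fun v => by
      rw [Real.norm_eq_abs, abs_of_nonneg (hp0 v), Real.norm_eq_abs]; exact hph v)
  have hIm : Integrable hm (stdGaussian E) :=
    hL1.norm.mono' hmm.aestronglyMeasurable (ae_of_all _ fun v => by
      rw [Real.norm_eq_abs, abs_of_nonneg (hm0 v), Real.norm_eq_abs]; exact hmh v)
  haveI : IsFiniteMeasure μp := isFiniteMeasure_withDensity_ofReal hIp.hasFiniteIntegral
  haveI : IsFiniteMeasure μm := isFiniteMeasure_withDensity_ofReal hIm.hasFiniteIntegral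
  have hchar : charFun μp = charFun μm := by
    funext t
    exact tendsto_nhds_unique (tendsto_charFun_withDensity hh hpm hp0 hph t)
      ((tendsto_charFun_withDensity hh hmm hm0 hmh t).congr fun N => by simp_rw [heq])
  have hμ : μp = μm := Measure.ext_of_charFun hchar
  -- hence `hp = hm` a.e.
  have hae : (fun v => ENNReal.ofReal (hp v)) =ᵐ[stdGaussian E] fun v => ENNReal.ofReal (hm v) := by
    refine (withDensity_eq_iff hpm.ennreal_ofReal.aemeasurable hmm.ennreal_ofReal.aemeasurable ?_).1 hμ
    exact (lintegral_ofReal_ne_top_iff_integrable hpm.aestronglyMeasurable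
      (ae_of_all _ hp0)).2 hIp |> fun h => h
  filter_upwards [hae] with v hv
  have := (ENNReal.ofReal_eq_ofReal_iff (hp0 v) (hm0 v)).1 hv
  rw [Pi.zero_apply, ← hsub v, this, sub_self]

/-! ### Density in `L²(γ)` -/

omit [DecidableEq ι] in
/-- A Wick polynomial is in `L²(γ)`. [folklore] -/
theorem memLp_two_hermiteEval (b : OrthonormalBasis ι ℝ E) (q : MvPolynomial ι ℝ) :
    MemLp (hermiteEval b q) 2 (stdGaussian E) :=
  (memLp_two_iff_integrable_sq (continuous_hermiteEval b q).aestronglyMeasurable).2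
    (integrable_hermiteEval_sq b q)

/-- The Wick polynomials as elements of the Hilbert space `L²(γ)`: a linear map. [folklore] -/
def hermiteEvalLp (b : OrthonormalBasis ι ℝ E) : MvPolynomial ι ℝ →ₗ[ℝ] Lp ℝ 2 (stdGaussian E) where
  toFun q := (memLp_two_hermiteEval b q).toLp (hermiteEval b q)
  map_add' p q := by
    rw [← MemLp.toLp_add]
    congr 1
    funext v; exact hermiteEval_add b p q v
  map_smul' c q := by
    rw [RingHom.id_apply, ← MemLp.toLp_const_smul]
    congr 1
    funext v; rw [Pi.smul_apply, smul_eq_mul, hermiteEval_smul]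

/-- The orthogonal complement of the Wick polynomials in `L²(γ)` is trivial. [cite: Janson1997, Thm 2.6] -/
theorem orthogonal_range_hermiteEvalLp_eq_bot (b : OrthonormalBasis ι ℝ E) :
    (LinearMap.range (hermiteEvalLp (E := E) b))ᗮ = ⊥ := by
  rw [Submodule.eq_bot_iff]
  intro f hf
  rw [Submodule.mem_orthogonal] at hf
  have h0 : ∀ q : MvPolynomial ι ℝ, ∫ v, f v * hermiteEval b q v ∂stdGaussian E = 0 := by
    intro q
    have h := hf (hermiteEvalLp b q) ⟨q, rfl⟩
    rw [MeasureTheory.L2.inner_def] at h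
    rw [← h]
    refine integral_congr_ae ?_
    filter_upwards [MemLp.coeFn_toLp (memLp_two_hermiteEval b q)] with v hv
    change f v * hermiteEval b q v = ⟪(hermiteEvalLp b q : E → ℝ) v, f v⟫_ℝ
    rw [show (hermiteEvalLp b q : E → ℝ) v = hermiteEval b q v from hv]
    simp
  have hae := ae_eq_zero_of_forall_integral_mul_hermiteEval_eq_zero b
    (Lp.stronglyMeasurable f).measurable (Lp.memLp f) h0
  exact Lp.eq_zero_iff_ae_eq_zero.2 hae

/-- **Polynomials are dense in `L²(γ)`** (Janson 1997, Thm 2.11): for `g ∈ L²(γ)` and `ε > 0`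
there is a polynomial `q` with `‖g - 𝓗_b q‖_{L²(γ)} < ε`. [cite: Janson1997, Thm 2.11] -/
theorem exists_hermiteEval_sub_eLpNorm_lt (b : OrthonormalBasis ι ℝ E) {g : E → ℝ}
    (hg : MemLp g 2 (stdGaussian E)) {ε : ℝ} (hε : 0 < ε) :
    ∃ q : MvPolynomial ι ℝ, eLpNorm (fun v => g v - hermiteEval b q v) 2 (stdGaussian E) < ENNReal.ofReal ε := by
  set V := LinearMap.range (hermiteEvalLp (E := E) b) with hV
  have hdense : V.topologicalClosure = ⊤ :=
    Submodule.topologicalClosure_eq_top_iff.2 (orthogonal_range_hermiteEvalLp_eq_bot b)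
  set F : Lp ℝ 2 (stdGaussian E) := hg.toLp g
  have hF : F ∈ V.topologicalClosure := by rw [hdense]; trivial
  rw [← SetLike.mem_coe, Submodule.topologicalClosure_coe, Metric.mem_closure_iff] at hF
  obtain ⟨y, hy, hdist⟩ := hF ε hε
  obtain ⟨q, rfl⟩ := hy
  refine ⟨q, ?_⟩
  have hsub : F - hermiteEvalLp b q = (hg.sub (memLp_two_hermiteEval b q)).toLp (g - hermiteEval b q) := by
    rw [MemLp.toLp_sub hg (memLp_two_hermiteEval b q)]; rfl
  have hnorm : dist F (hermiteEvalLp b q) = (eLpNorm (g - hermiteEval b q) 2 (stdGaussian E)).toReal := by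
    rw [dist_eq_norm, hsub, Lp.norm_toLp]
  rw [hnorm] at hdist
  have hne : eLpNorm (g - hermiteEval b q) 2 (stdGaussian E) ≠ ⊤ :=
    (hg.sub (memLp_two_hermiteEval b q)).eLpNorm_ne_top
  exact (ENNReal.lt_ofReal_iff_toReal_lt hne).2 hdist

end

end Literature.Probability.Distributions
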